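import Mathlib
import HarnessLib
import Summits.HubbardSuperconductivity.HubbardSuperconductivity.Theorems.KLProgrammeKLRegimeEngineLadderFlow

/-!
# Route `KLProgramme` — crux K3, ENGINE child gen 8 (stmt-HubbardSuperconductivity-20437 `KLRegimeEngineV17F2`), stub (c) `stub_engine_step_values`,
# (R47h) v2 / RIDER (A): the LINEARLY DRESSED flow along the slice — `kltc_linear_dressing_gronwall`, and the exact tangent-flow conjugation identity

Cell gate-hubbard-kl, seat hubbard-kl-k3c1-p1 (g9), technique «composed-map remainder propagation».

Every remainder tracker of the (c) lane along the slice `[Λ_n, Λ_{n−1}]` (parameter `t ∈ [0,1]`) — the sextic-tree remainder `R₆ = 𝒲₆ − 𝒲₄·C_>·𝒲₄` at chain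
labels (E2-GRIDPOINT-NOTE §5(a) `SexticTreeAt`, E2-TRANSFER-SQUARE §3 (R-WICK)), the all-degree chain remainders of (R-PLAIN), the transfer defect — obeys a
LINEAR two-sided dressing equation `Ė = Γ₁·diag ḃ₁·E + E·diag ḃ₂·Γ₂ + X` (new ladder links attach at either end of the tracked object through the rung
rate; everything else is the source `X`; a passive index such as the open link momentum is handled by applying the lemma pointwise in it).  This file:

* §1 **`kltc_linear_dressing_gronwall`** (generic finite carrier, sup form): entrywise-differentiable `E` on `[0,1]` with that equation (any complex
  `Γ_i(t)`, `ḃ_i(t)` — signs are the caller's), `|Γ_i(t)| ≤ m_i`, `Σ_a‖ḃ_i(t)_a‖ ≤ β_i`, `|E(0)| ≤ δ`, `|X(t)| ≤ ξ` ⟹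
  `|E(1)| ≤ gronwallBound δ (m₁β₁ + m₂β₂) ξ 1` entrywise (Mathlib's Gronwall in the Pi sup norm); `kltc_gronwallBound_split` and the numerical corollary
  **`kltc_linear_dressing_le`**: if `m₁β₁ + m₂β₂ ≤ 1` then `|E(1)| ≤ δ·exp(m₁β₁ + m₂β₂) + 2ξ`.
* §2 **`kltc_tangent_conj_identity`** (exact algebra, pointwise in `t`): with `P := 1 + Γ₁⁰·W₁`, `Q := 1 + W₂·Γ₂⁰` (`W_i = diag w_i`, `Ẇ_i = diag ḃ_i`) the
  conjugated object `P·E·Q` satisfies `d/dt(P·E·Q) = −(P·Γ₁ − Γ₁⁰)·Ẇ₁·E·Q − P·E·Ẇ₂·(Γ₂·Q − Γ₂⁰) + P·X·Q` whenever `Ė = −(Γ₁Ẇ₁E + EẆ₂Γ₂) + X`: the big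
  dressing terms CANCEL against `Ṗ·E·Q + P·E·Q̇`, leaving only the Bethe–Salpeter defects `P·Γ₁ − Γ₁⁰`, `Γ₂·Q − Γ₂⁰` of the two dressers (which are
  `O(∫|source|)` when `Γ_i` run their own Riccati flows, `kllf_duhamel`'s internal bound) — i.e. the linearly dressed flow is the TANGENT flow of the
  pair-ladder Riccati flow and is solved, up to those defects, by conjugation with the explicit resolvent factors; this is the identity from which a
  weighted (four-term) form of §1 follows by a Gronwall with SMALL constant (next file).

Real analysis + matrix algebra only; nothing about the model is asserted.  0 kit.
-/

noncomputable section

namespace Summit.HubbardSuperconductivity.HubbardSuperconductivity.Theorems.KLRegimeSplit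

set_option linter.dupNamespace false -- summit = problem name (single-conjunct summit), D-0017

open Finset Matrix Set

/-! ## §1 Sup-norm Gronwall for the two-sided linearly dressed flow -/

section Gronwall

variable {ι : Type*} [Fintype ι] [DecidableEq ι]

/-- `gronwallBound δ K ε x = δ·exp(Kx) + gronwallBound 0 K ε x`. -/
theorem kltc_gronwallBound_split (δ K ε x : ℝ) : gronwallBound δ K ε x = δ * Real.exp (K * x) + gronwallBound 0 K ε x := by
  by_cases hK : K = 0
  · subst hK; simp [gronwallBound_K0]
  · rw [gronwallBound_of_K_ne_0 hK, gronwallBound_of_K_ne_0 hK]; ring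

set_option maxHeartbeats 400000 in -- one entrywise-derivative bookkeeping proof
/-- **Sup-norm Gronwall for the two-sided linearly dressed flow.**  `E, Ė, X, Γ₁, Γ₂ : ℝ → Matrix ι ι ℂ`, `ḃ₁, ḃ₂ : ℝ → ι → ℂ` with, for every
`t ∈ [0,1]`: entrywise derivatives `HasDerivAt (E · x y) (Ė t x y) t`; the equation `Ė(t) = Γ₁(t)·diag(ḃ₁ t)·E(t) + E(t)·diag(ḃ₂ t)·Γ₂(t) + X(t)`;
`|Γ_i(t)| ≤ m_i`; `Σ_a ‖ḃ_i t a‖ ≤ β_i`; `|E(0)| ≤ δ`; `|X(t)| ≤ ξ` (all entrywise).  Then `|E(1)(x,y)| ≤ gronwallBound δ (m₁β₁ + m₂β₂) ξ 1`. -/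
theorem kltc_linear_dressing_gronwall (E E' X Γ₁ Γ₂ : ℝ → Matrix ι ι ℂ) (b₁' b₂' : ℝ → ι → ℂ) {m₁ m₂ β₁ β₂ δ ξ : ℝ}
    (hm₁ : 0 ≤ m₁) (hm₂ : 0 ≤ m₂) (hδ : 0 ≤ δ) (hξ : 0 ≤ ξ)
    (hE : ∀ t ∈ Icc (0 : ℝ) 1, ∀ x y, HasDerivAt (fun s => E s x y) (E' t x y) t)
    (hflow : ∀ t ∈ Icc (0 : ℝ) 1, E' t = Γ₁ t * diagonal (b₁' t) * E t + E t * diagonal (b₂' t) * Γ₂ t + X t)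
    (hΓ₁ : ∀ t ∈ Icc (0 : ℝ) 1, ∀ x y, ‖Γ₁ t x y‖ ≤ m₁) (hΓ₂ : ∀ t ∈ Icc (0 : ℝ) 1, ∀ x y, ‖Γ₂ t x y‖ ≤ m₂)
    (hβ₁ : ∀ t ∈ Icc (0 : ℝ) 1, ∑ a, ‖b₁' t a‖ ≤ β₁) (hβ₂ : ∀ t ∈ Icc (0 : ℝ) 1, ∑ a, ‖b₂' t a‖ ≤ β₂)
    (hE0 : ∀ x y, ‖E 0 x y‖ ≤ δ) (hX : ∀ t ∈ Icc (0 : ℝ) 1, ∀ x y, ‖X t x y‖ ≤ ξ) (x y : ι) :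
    ‖E 1 x y‖ ≤ gronwallBound δ (m₁ * β₁ + m₂ * β₂) ξ 1 := by
  have h01 : (0 : ℝ) ∈ Icc (0 : ℝ) 1 := ⟨le_rfl, zero_le_one⟩
  have hβ₁0 : 0 ≤ β₁ := (sum_nonneg fun a _ => norm_nonneg _).trans (hβ₁ 0 h01)
  have hβ₂0 : 0 ≤ β₂ := (sum_nonneg fun a _ => norm_nonneg _).trans (hβ₂ 0 h01)
  -- the Pi-valued curve
  set f : ℝ → (ι × ι → ℂ) := fun t p => E t p.1 p.2 with hf_def
  set f' : ℝ → (ι × ι → ℂ) := fun t p => E' t p.1 p.2 with hf'_def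
  have hfderiv : ∀ t ∈ Icc (0 : ℝ) 1, HasDerivAt f (f' t) t := by
    intro t ht
    rw [hasDerivAt_pi]
    intro p
    exact hE t ht p.1 p.2
  have hfcont : ContinuousOn f (Icc (0 : ℝ) 1) := fun t ht => (hfderiv t ht).continuousAt.continuousWithinAt
  have hf0 : ‖f 0‖ ≤ δ := by
    rw [pi_norm_le_iff_of_nonneg hδ]
    rintro ⟨a, c⟩
    exact hE0 a c
  -- the differential inequality
  have hbound : ∀ t ∈ Ico (0 : ℝ) 1, ‖f' t‖ ≤ (m₁ * β₁ + m₂ * β₂) * ‖f t‖ + ξ := by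
    intro t ht
    have ht' : t ∈ Icc (0 : ℝ) 1 := Ico_subset_Icc_self ht
    have hnn : 0 ≤ (m₁ * β₁ + m₂ * β₂) * ‖f t‖ + ξ := by positivity
    rw [pi_norm_le_iff_of_nonneg hnn]
    rintro ⟨a, c⟩
    show ‖E' t a c‖ ≤ (m₁ * β₁ + m₂ * β₂) * ‖f t‖ + ξ
    rw [hflow t ht', Matrix.add_apply, Matrix.add_apply]
    have hfe : ∀ u v, ‖E t u v‖ ≤ ‖f t‖ := fun u v => norm_le_pi_norm (f t) (u, v)
    have h1 : ‖(Γ₁ t * diagonal (b₁' t) * E t) a c‖ ≤ m₁ * β₁ * ‖f t‖ := by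
      rw [klli_mul_diag_mul_apply]
      calc ‖∑ d, Γ₁ t a d * b₁' t d * E t d c‖ ≤ ∑ d, ‖Γ₁ t a d * b₁' t d * E t d c‖ := norm_sum_le _ _
        _ ≤ ∑ d, m₁ * ‖b₁' t d‖ * ‖f t‖ := by
            refine sum_le_sum fun d _ => ?_
            rw [norm_mul, norm_mul]
            exact mul_le_mul (mul_le_mul_of_nonneg_right (hΓ₁ t ht' a d) (norm_nonneg _)) (hfe d c) (norm_nonneg _)
              (mul_nonneg hm₁ (norm_nonneg _))
        _ = m₁ * (∑ d, ‖b₁' t d‖) * ‖f t‖ := by rw [mul_sum, sum_mul]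
        _ ≤ m₁ * β₁ * ‖f t‖ := mul_le_mul_of_nonneg_right (mul_le_mul_of_nonneg_left (hβ₁ t ht') hm₁) (norm_nonneg _)
    have h2 : ‖(E t * diagonal (b₂' t) * Γ₂ t) a c‖ ≤ m₂ * β₂ * ‖f t‖ := by
      rw [klli_mul_diag_mul_apply]
      calc ‖∑ d, E t a d * b₂' t d * Γ₂ t d c‖ ≤ ∑ d, ‖E t a d * b₂' t d * Γ₂ t d c‖ := norm_sum_le _ _
        _ ≤ ∑ d, ‖f t‖ * ‖b₂' t d‖ * m₂ := by
            refine sum_le_sum fun d _ => ?_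
            rw [norm_mul, norm_mul]
            exact mul_le_mul (mul_le_mul_of_nonneg_right (hfe a d) (norm_nonneg _)) (hΓ₂ t ht' d c) (norm_nonneg _)
              (mul_nonneg (norm_nonneg _) (norm_nonneg _))
        _ = ‖f t‖ * (∑ d, ‖b₂' t d‖) * m₂ := by rw [mul_sum, sum_mul]
        _ ≤ ‖f t‖ * β₂ * m₂ :=
            mul_le_mul_of_nonneg_right (mul_le_mul_of_nonneg_left (hβ₂ t ht') (norm_nonneg _)) hm₂
        _ = m₂ * β₂ * ‖f t‖ := by ring
    calc ‖(Γ₁ t * diagonal (b₁' t) * E t) a c + (E t * diagonal (b₂' t) * Γ₂ t) a c + X t a c‖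
        ≤ ‖(Γ₁ t * diagonal (b₁' t) * E t) a c‖ + ‖(E t * diagonal (b₂' t) * Γ₂ t) a c‖ + ‖X t a c‖ := norm_add₃_le
      _ ≤ m₁ * β₁ * ‖f t‖ + m₂ * β₂ * ‖f t‖ + ξ := add_le_add (add_le_add h1 h2) (hX t ht' a c)
      _ = (m₁ * β₁ + m₂ * β₂) * ‖f t‖ + ξ := by ring
  -- Gronwall
  have hgron := norm_le_gronwallBound_of_norm_deriv_right_le (a := 0) (b := 1) hfcont
    (fun t ht => (hfderiv t (Ico_subset_Icc_self ht)).hasDerivWithinAt) hf0 hbound 1 (by norm_num)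
  rw [sub_zero] at hgron
  exact (norm_le_pi_norm (f 1) (x, y)).trans hgron

/-- **Numerical form.**  Under the hypotheses of `kltc_linear_dressing_gronwall` and `m₁β₁ + m₂β₂ ≤ 1`:
`|E(1)(x,y)| ≤ δ·exp(m₁β₁ + m₂β₂) + 2ξ`. -/
theorem kltc_linear_dressing_le (E E' X Γ₁ Γ₂ : ℝ → Matrix ι ι ℂ) (b₁' b₂' : ℝ → ι → ℂ) {m₁ m₂ β₁ β₂ δ ξ : ℝ}
    (hm₁ : 0 ≤ m₁) (hm₂ : 0 ≤ m₂) (hδ : 0 ≤ δ) (hξ : 0 ≤ ξ)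
    (hE : ∀ t ∈ Icc (0 : ℝ) 1, ∀ x y, HasDerivAt (fun s => E s x y) (E' t x y) t)
    (hflow : ∀ t ∈ Icc (0 : ℝ) 1, E' t = Γ₁ t * diagonal (b₁' t) * E t + E t * diagonal (b₂' t) * Γ₂ t + X t)
    (hΓ₁ : ∀ t ∈ Icc (0 : ℝ) 1, ∀ x y, ‖Γ₁ t x y‖ ≤ m₁) (hΓ₂ : ∀ t ∈ Icc (0 : ℝ) 1, ∀ x y, ‖Γ₂ t x y‖ ≤ m₂)
    (hβ₁ : ∀ t ∈ Icc (0 : ℝ) 1, ∑ a, ‖b₁' t a‖ ≤ β₁) (hβ₂ : ∀ t ∈ Icc (0 : ℝ) 1, ∑ a, ‖b₂' t a‖ ≤ β₂)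
    (hE0 : ∀ x y, ‖E 0 x y‖ ≤ δ) (hX : ∀ t ∈ Icc (0 : ℝ) 1, ∀ x y, ‖X t x y‖ ≤ ξ) (hK : m₁ * β₁ + m₂ * β₂ ≤ 1) (x y : ι) :
    ‖E 1 x y‖ ≤ δ * Real.exp (m₁ * β₁ + m₂ * β₂) + 2 * ξ := by
  have h01 : (0 : ℝ) ∈ Icc (0 : ℝ) 1 := ⟨le_rfl, zero_le_one⟩
  have hβ₁0 : 0 ≤ β₁ := (sum_nonneg fun a _ => norm_nonneg _).trans (hβ₁ 0 h01)
  have hβ₂0 : 0 ≤ β₂ := (sum_nonneg fun a _ => norm_nonneg _).trans (hβ₂ 0 h01)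
  have hK0 : 0 ≤ m₁ * β₁ + m₂ * β₂ := by positivity
  have h := kltc_linear_dressing_gronwall E E' X Γ₁ Γ₂ b₁' b₂' hm₁ hm₂ hδ hξ hE hflow hΓ₁ hΓ₂ hβ₁ hβ₂ hE0 hX x y
  rw [kltc_gronwallBound_split, mul_one] at h
  exact h.trans (add_le_add le_rfl (kllf_gronwall_const hK0 hK hξ))

end Gronwall

/-! ## §2 The exact tangent-flow conjugation identity -/

section Tangent

variable {ι : Type*} [Fintype ι] [DecidableEq ι]

/-- **Tangent-flow conjugation (exact).**  For matrices `E Ė X Γ₁ Γ₂ Γ₁⁰ Γ₂⁰ W₁ W₂ Ẇ₁ Ẇ₂` with the linearly dressed equation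
`Ė = −(Γ₁·Ẇ₁·E + E·Ẇ₂·Γ₂) + X`, the conjugators `P := 1 + Γ₁⁰·W₁`, `Q := 1 + W₂·Γ₂⁰` (whose derivatives along a curve `W_i(t)` with `Ẇ_i = dW_i/dt` are
`Γ₁⁰·Ẇ₁`, `Ẇ₂·Γ₂⁰`) satisfy the product-rule identity
`Γ₁⁰Ẇ₁·E·Q + P·Ė·Q + P·E·Ẇ₂Γ₂⁰ = −(PΓ₁ − Γ₁⁰)·Ẇ₁·E·Q − P·E·Ẇ₂·(Γ₂Q − Γ₂⁰) + P·X·Q`: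
the dressing terms cancel, only the Bethe–Salpeter defects `PΓ₁ − Γ₁⁰`, `Γ₂Q − Γ₂⁰` of the dressers remain. -/
theorem kltc_tangent_conj_identity (E E' X Γ₁ Γ₂ Γ₁0 Γ₂0 W₁ W₂ W₁' W₂' : Matrix ι ι ℂ)
    (hflow : E' = -(Γ₁ * W₁' * E + E * W₂' * Γ₂) + X) :
    Γ₁0 * W₁' * E * (1 + W₂ * Γ₂0) + (1 + Γ₁0 * W₁) * E' * (1 + W₂ * Γ₂0) + (1 + Γ₁0 * W₁) * E * (W₂' * Γ₂0) =
      -((1 + Γ₁0 * W₁) * Γ₁ - Γ₁0) * W₁' * E * (1 + W₂ * Γ₂0) -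
        (1 + Γ₁0 * W₁) * E * W₂' * (Γ₂ * (1 + W₂ * Γ₂0) - Γ₂0) + (1 + Γ₁0 * W₁) * X * (1 + W₂ * Γ₂0) := by
  rw [hflow]
  noncomm_ring

/-- **The conjugated defect's derivative, entrywise.**  Along curves `E(t)`, `w₁(t)`, `w₂(t)` on `[0,1]` with entrywise derivatives `Ė(t)`, `ḃ₁(t)`,
`ḃ₂(t)`, the conjugated object `D(t) := (1 + Γ₁⁰·diag w₁(t))·E(t)·(1 + diag w₂(t)·Γ₂⁰)` has the entrywise derivative
`Γ₁⁰·diag ḃ₁·E·Q + P·Ė·Q + P·E·diag ḃ₂·Γ₂⁰` (product rule; no inverse is differentiated). -/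
theorem kltc_tangent_conj_hasDerivAt (E E' : ℝ → Matrix ι ι ℂ) (Γ₁0 Γ₂0 : Matrix ι ι ℂ) (w₁ w₂ b₁' b₂' : ℝ → ι → ℂ) {t : ℝ}
    (hE : ∀ x y, HasDerivAt (fun s => E s x y) (E' t x y) t)
    (hw₁ : ∀ a, HasDerivAt (fun s => w₁ s a) (b₁' t a) t) (hw₂ : ∀ a, HasDerivAt (fun s => w₂ s a) (b₂' t a) t) (x y : ι) :
    HasDerivAt (fun s => ((1 + Γ₁0 * diagonal (w₁ s)) * E s * (1 + diagonal (w₂ s) * Γ₂0)) x y)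
      ((Γ₁0 * diagonal (b₁' t) * E t * (1 + diagonal (w₂ t) * Γ₂0) +
        (1 + Γ₁0 * diagonal (w₁ t)) * E' t * (1 + diagonal (w₂ t) * Γ₂0) +
        (1 + Γ₁0 * diagonal (w₁ t)) * E t * (diagonal (b₂' t) * Γ₂0)) x y) t := by
  -- entry formula for the triple product with affine-diagonal outer factors
  have hentry : ∀ (F : Matrix ι ι ℂ) (u v : ι → ℂ),
      ((1 + Γ₁0 * diagonal u) * F * (1 + diagonal v * Γ₂0)) x y =
        ∑ c, (∑ a, ((1 : Matrix ι ι ℂ) x a + Γ₁0 x a * u a) * F a c) * ((1 : Matrix ι ι ℂ) c y + v c * Γ₂0 c y) := by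
    intro F u v
    rw [Matrix.mul_apply]
    refine sum_congr rfl fun c _ => ?_
    rw [Matrix.mul_apply, Matrix.add_apply, Matrix.diagonal_mul]
    congr 1
    refine sum_congr rfl fun a _ => ?_
    rw [Matrix.add_apply, Matrix.mul_diagonal]
  have hentry' : ∀ (F G : Matrix ι ι ℂ) (u v u' v' : ι → ℂ),
      (Γ₁0 * diagonal u' * F * (1 + diagonal v * Γ₂0) + (1 + Γ₁0 * diagonal u) * G * (1 + diagonal v * Γ₂0) +
          (1 + Γ₁0 * diagonal u) * F * (diagonal v' * Γ₂0)) x y =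
        ∑ c, ((∑ a, ((Γ₁0 x a * u' a) * F a c + ((1 : Matrix ι ι ℂ) x a + Γ₁0 x a * u a) * G a c)) *
            ((1 : Matrix ι ι ℂ) c y + v c * Γ₂0 c y) +
          (∑ a, ((1 : Matrix ι ι ℂ) x a + Γ₁0 x a * u a) * F a c) * (v' c * Γ₂0 c y)) := by
    intro F G u v u' v'
    rw [Matrix.add_apply, Matrix.add_apply, hentry G u v]
    have h1 : (Γ₁0 * diagonal u' * F * (1 + diagonal v * Γ₂0)) x y =
        ∑ c, (∑ a, (Γ₁0 x a * u' a) * F a c) * ((1 : Matrix ι ι ℂ) c y + v c * Γ₂0 c y) := by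
      rw [Matrix.mul_apply]
      refine sum_congr rfl fun c _ => ?_
      rw [Matrix.mul_apply, Matrix.add_apply, Matrix.diagonal_mul]
      congr 1
      exact sum_congr rfl fun a _ => by rw [Matrix.mul_diagonal]
    have h3 : ((1 + Γ₁0 * diagonal u) * F * (diagonal v' * Γ₂0)) x y =
        ∑ c, (∑ a, ((1 : Matrix ι ι ℂ) x a + Γ₁0 x a * u a) * F a c) * (v' c * Γ₂0 c y) := by
      rw [Matrix.mul_apply]
      refine sum_congr rfl fun c _ => ?_
      rw [Matrix.mul_apply, Matrix.diagonal_mul]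
      congr 1
      refine sum_congr rfl fun a _ => ?_
      rw [Matrix.add_apply, Matrix.mul_diagonal]
    rw [h1, h3, ← sum_add_distrib, ← sum_add_distrib]
    refine sum_congr rfl fun c _ => ?_
    rw [sum_add_distrib]
    ring
  rw [hentry']
  have hfun : (fun s => ((1 + Γ₁0 * diagonal (w₁ s)) * E s * (1 + diagonal (w₂ s) * Γ₂0)) x y) =
      fun s => ∑ c, (∑ a, ((1 : Matrix ι ι ℂ) x a + Γ₁0 x a * w₁ s a) * E s a c) * ((1 : Matrix ι ι ℂ) c y + w₂ s c * Γ₂0 c y) := by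
    funext s; exact hentry (E s) (w₁ s) (w₂ s)
  rw [hfun]
  refine HasDerivAt.fun_sum (u := (Finset.univ : Finset ι)) fun c _ => ?_
  -- inner sum
  have hinner : HasDerivAt (fun s => ∑ a, ((1 : Matrix ι ι ℂ) x a + Γ₁0 x a * w₁ s a) * E s a c)
      (∑ a, ((Γ₁0 x a * b₁' t a) * E t a c + ((1 : Matrix ι ι ℂ) x a + Γ₁0 x a * w₁ t a) * E' t a c)) t := by
    refine HasDerivAt.fun_sum (u := (Finset.univ : Finset ι)) fun a _ => ?_
    have h1 : HasDerivAt (fun s => (1 : Matrix ι ι ℂ) x a + Γ₁0 x a * w₁ s a) (Γ₁0 x a * b₁' t a) t := by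
      have := ((hw₁ a).const_mul (Γ₁0 x a)).const_add ((1 : Matrix ι ι ℂ) x a)
      simpa using this
    have h2 : HasDerivAt (fun s => E s a c) (E' t a c) t := hE a c
    have h12 := h1.mul h2
    refine h12.congr_deriv ?_
    ring
  have houter : HasDerivAt (fun s => (1 : Matrix ι ι ℂ) c y + w₂ s c * Γ₂0 c y) (b₂' t c * Γ₂0 c y) t := by
    have := ((hw₂ c).mul_const (Γ₂0 c y)).const_add ((1 : Matrix ι ι ℂ) c y)
    simpa using this
  have h := hinner.mul houter
  refine h.congr_deriv ?_
  ring

end Tangent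

/-! ## §3 Entrywise plumbing for the tangent Duhamel bound

Generic lemmas used by `kltc_tangent_duhamel` (`…EnginePairLadderTangentDuhamel`): the two-weight affine sandwich
`(1 + C′·diag d₁)·S·(1 + diag d₂·T)` entrywise, row/column sums of the affine conjugators, and continuity of entries of products / sums /
diagonals of entrywise-continuous matrix curves (for the FTC step). -/

section Plumbing

variable {ι : Type*} [Fintype ι] [DecidableEq ι]

/-- Two-weight affine sandwich, entrywise: `‖((1 + C′·diag d₁)·S·(1 + diag d₂·T))(x,y)‖ ≤` the four-term form. -/
theorem kltc_sandwich2_entry_le (C' S T : Matrix ι ι ℂ) (d₁ d₂ : ι → ℂ) (x y : ι) :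
    ‖((1 + C' * diagonal d₁) * S * (1 + diagonal d₂ * T)) x y‖ ≤
      ‖S x y‖ + ∑ c, ‖S x c‖ * ‖d₂ c‖ * ‖T c y‖ + ∑ a, ‖C' x a‖ * ‖d₁ a‖ * ‖S a y‖ +
        ∑ a, ∑ c, ‖C' x a‖ * ‖d₁ a‖ * ‖S a c‖ * ‖d₂ c‖ * ‖T c y‖ := by
  have hexp : (1 + C' * diagonal d₁) * S * (1 + diagonal d₂ * T) =
      S + S * diagonal d₂ * T + C' * diagonal d₁ * S + C' * diagonal d₁ * S * diagonal d₂ * T := by noncomm_ring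
  rw [hexp, Matrix.add_apply, Matrix.add_apply, Matrix.add_apply]
  have h2 : ‖(S * diagonal d₂ * T) x y‖ ≤ ∑ c, ‖S x c‖ * ‖d₂ c‖ * ‖T c y‖ := by
    rw [klli_mul_diag_mul_apply]
    refine (norm_sum_le _ _).trans (le_of_eq (sum_congr rfl fun c _ => ?_))
    rw [norm_mul, norm_mul]
  have h3 : ∀ c, ‖(C' * diagonal d₁ * S) x c‖ ≤ ∑ a, ‖C' x a‖ * ‖d₁ a‖ * ‖S a c‖ := by
    intro c
    rw [klli_mul_diag_mul_apply]
    refine (norm_sum_le _ _).trans (le_of_eq (sum_congr rfl fun a _ => ?_))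
    rw [norm_mul, norm_mul]
  have h4 : ‖(C' * diagonal d₁ * S * diagonal d₂ * T) x y‖ ≤ ∑ a, ∑ c, ‖C' x a‖ * ‖d₁ a‖ * ‖S a c‖ * ‖d₂ c‖ * ‖T c y‖ := by
    rw [klli_mul_diag_mul_apply]
    calc ‖∑ c, (C' * diagonal d₁ * S) x c * d₂ c * T c y‖ ≤ ∑ c, ‖(C' * diagonal d₁ * S) x c‖ * ‖d₂ c‖ * ‖T c y‖ := by
          refine (norm_sum_le _ _).trans (le_of_eq (sum_congr rfl fun c _ => ?_))
          rw [norm_mul, norm_mul]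
      _ ≤ ∑ c, (∑ a, ‖C' x a‖ * ‖d₁ a‖ * ‖S a c‖) * ‖d₂ c‖ * ‖T c y‖ :=
          sum_le_sum fun c _ => mul_le_mul_of_nonneg_right (mul_le_mul_of_nonneg_right (h3 c) (norm_nonneg _)) (norm_nonneg _)
      _ = ∑ a, ∑ c, ‖C' x a‖ * ‖d₁ a‖ * ‖S a c‖ * ‖d₂ c‖ * ‖T c y‖ := by
          rw [sum_comm]
          refine sum_congr rfl fun c _ => ?_
          rw [sum_mul, sum_mul]
  calc ‖S x y + (S * diagonal d₂ * T) x y + (C' * diagonal d₁ * S) x y + (C' * diagonal d₁ * S * diagonal d₂ * T) x y‖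
      ≤ ‖S x y + (S * diagonal d₂ * T) x y + (C' * diagonal d₁ * S) x y‖ + ‖(C' * diagonal d₁ * S * diagonal d₂ * T) x y‖ := norm_add_le _ _
    _ ≤ ‖S x y‖ + ‖(S * diagonal d₂ * T) x y‖ + ‖(C' * diagonal d₁ * S) x y‖ + ‖(C' * diagonal d₁ * S * diagonal d₂ * T) x y‖ :=
        add_le_add norm_add₃_le le_rfl
    _ ≤ _ := add_le_add (add_le_add (add_le_add le_rfl h2) (h3 y)) h4

/-- Column sums of a right affine factor: `Σ_c ‖(1 + diag d·T)(c,y)‖ ≤ 1 + Σ_c ‖d c‖·‖T c y‖`. -/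
theorem kltc_colsum_affine_le (T : Matrix ι ι ℂ) (d : ι → ℂ) (y : ι) :
    ∑ c, ‖(1 + diagonal d * T) c y‖ ≤ 1 + ∑ c, ‖d c‖ * ‖T c y‖ := by
  have h : ∀ c, ‖(1 + diagonal d * T) c y‖ ≤ ‖(1 : Matrix ι ι ℂ) c y‖ + ‖d c‖ * ‖T c y‖ := by
    intro c
    rw [Matrix.add_apply, diagonal_mul, ← norm_mul]
    exact norm_add_le _ _
  refine (sum_le_sum fun c _ => h c).trans ?_
  rw [sum_add_distrib]
  refine add_le_add (le_of_eq ?_) le_rfl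
  rw [Finset.sum_eq_single y]
  · simp
  · intro c _ hc; simp [Matrix.one_apply_ne hc]
  · intro h; exact absurd (Finset.mem_univ y) h

/-- Row sums of a left affine factor: `Σ_a ‖(1 + C·diag d)(x,a)‖ ≤ 1 + Σ_a ‖C x a‖·‖d a‖`. -/
theorem kltc_rowsum_affine_le (C : Matrix ι ι ℂ) (d : ι → ℂ) (x : ι) :
    ∑ a, ‖(1 + C * diagonal d) x a‖ ≤ 1 + ∑ a, ‖C x a‖ * ‖d a‖ := by
  have h : ∀ a, ‖(1 + C * diagonal d) x a‖ ≤ ‖(1 : Matrix ι ι ℂ) x a‖ + ‖C x a‖ * ‖d a‖ := by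
    intro a
    rw [Matrix.add_apply, mul_diagonal, ← norm_mul]
    exact norm_add_le _ _
  refine (sum_le_sum fun a _ => h a).trans ?_
  rw [sum_add_distrib]
  refine add_le_add (le_of_eq ?_) le_rfl
  rw [Finset.sum_eq_single x]
  · simp
  · intro a _ ha; simp [Matrix.one_apply_ne' ha]
  · intro h; exact absurd (Finset.mem_univ x) h

omit [DecidableEq ι] in
/-- Entries of a product of entrywise-continuous matrix curves are continuous. -/
theorem kltc_continuousOn_mul_apply {s : Set ℝ} {A B : ℝ → Matrix ι ι ℂ} (hA : ∀ x y, ContinuousOn (fun t => A t x y) s)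
    (hB : ∀ x y, ContinuousOn (fun t => B t x y) s) (x y : ι) : ContinuousOn (fun t => (A t * B t) x y) s := by
  have h : ∀ t, (A t * B t) x y = ∑ a, A t x a * B t a y := fun t => Matrix.mul_apply
  simp_rw [h]
  exact continuousOn_finsetSum _ fun a _ => (hA x a).mul (hB a y)

omit [Fintype ι] [DecidableEq ι] in
/-- Entries of a sum of entrywise-continuous matrix curves are continuous. -/
theorem kltc_continuousOn_add_apply {s : Set ℝ} {A B : ℝ → Matrix ι ι ℂ} (hA : ∀ x y, ContinuousOn (fun t => A t x y) s)
    (hB : ∀ x y, ContinuousOn (fun t => B t x y) s) (x y : ι) : ContinuousOn (fun t => (A t + B t) x y) s := by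
  have h : ∀ t, (A t + B t) x y = A t x y + B t x y := fun t => rfl
  simp_rw [h]
  exact (hA x y).add (hB x y)

omit [Fintype ι] in
/-- Entries of `diagonal (d t)` are continuous when the `d · a` are. -/
theorem kltc_continuousOn_diagonal_apply {s : Set ℝ} {d : ℝ → ι → ℂ} (hd : ∀ a, ContinuousOn (fun t => d t a) s) (x y : ι) :
    ContinuousOn (fun t => diagonal (d t) x y) s := by
  by_cases h : x = y
  · subst h; simp_rw [diagonal_apply_eq]; exact hd x
  · simp_rw [diagonal_apply_ne _ h]; exact continuousOn_const

end Plumbing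

end Summit.HubbardSuperconductivity.HubbardSuperconductivity.Theorems.KLRegimeSplit

end
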